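import Summits.QuantumFields.BalabanUV.Beta.EriceRemainderEnclosureHistoryAutonomyComparisonAgeCompositionStaticEndLevels
import Summits.QuantumFields.BalabanUV.Beta.EriceRemainderEnclosureHistoryAutonomyComparisonAgeCompositionStaticEndOldestFlow

/-!
# EriceRemainderEnclosureHistoryAutonomyComparisonAgeCompositionStaticEndLevelsFlow — (E83h) route (N), first order: (E83g)'s END FOR THE FLOW; THE TWO-AGE
# END ON ONE STATIC FAMILY — (S-a) for the old age — for every box solution and every damping in the relaxed class; and THE UNDAMPED TWO-AGE END WITH NO
# HYPOTHESIS LEFT: in the undamped first-order model of route (N) the comparison surplus of every admissible excess is non-negative along every box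
# solution dominated by a two-age profile `{1, k}` — the first unconditional instance of the first-order END beyond the single age ((E81b) `flow_nonneg_two`)

Cell `pub-balaban`, β-function sub-cell, BINDER row D4 «RemainderConst leaves for Bałaban's split» (`HOME/BINDER-OWNERS.md`; owner lineage `b2b-balaban-beta-an4`;
this file by co-owner #2 lineage `b2b-balaban-beta-d4-p2`, generation 74), β-FLOW TEAM duty (1), FREEZE (0) honoured (def-free; imports (E83g) `…StaticEndLevels`
and (E82e) `…StaticEndOldestFlow`; uses (E75a), (E80e), (E81d), (E81i), (E82c), (E82e), (E83g) BY NAME; the wrappers are (E82e)'s with hypotheses gone).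

HONEST FRAMING (page 1, verbatim and binding).  *"Discharging BetaPertH makes Bałaban's UV stability UNCONDITIONAL — a real constructive-QFT result; it is
NOT the continuum limit and NOT the Clay problem."*  THIS FILE DISCHARGES NOTHING OF THE KIND.  Elementary real analysis about ABSTRACT functionals on a box
]0,γ]^ℕ with displayed floors, profiles and signs, and the FIRST-ORDER renewal objects of route (N) built from them — hypotheses of a census, not facts; the
form, signs, ages and moments of Bałaban's (1.22) limit functional are NOT PRINTED ([I] p. 298; GAPS G-t4-U2-1∕-2) and NOT asserted.  Row D4 class
UNCHANGED (critical-path width 0; instance 0∕1; D4 DISCHARGE NO DATE).  HONEST DEPENDENCY: continuum YM on T⁴ ⇐ BetaPertH ∧ nine spine estimates (0/9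
proved); BetaPertH ⇐ (D1) ∧ (D4) ∧ CAP+tail; G-an2-4 gates asym, D1 and NE2/3/4.

THE POINT (census sense (α); route (N); README `HOME/b2b-balaban-beta-d4-p2/g74/e83/README.md`).  §1 **`flow_nonneg_of_static_families_levels`**: (E82e)'s
wrapper on (E83g) `nonneg_of_static_families_levels` — (S-a) for the ages `≥ 2`, (S-b) for the ages `< K − 1`, and (S-c♯) only at the levels named by the
predicate `P`, every level `i < K − 1` being one-lag, silent, or followed by a `P`-level.  §2 **`flow_nonneg_two_ages_rowmass`**: for a two-age profile
`{1, k}` (`2 ≤ k`, horizon `K = k + 1`), every box solution and EVERY damping with `1∕(1+F_t) ≤ g_t ≤ 1`, the first-order comparison surplus `ε` of every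
admissible excess `e` is non-negative GIVEN ONLY (S-a) for the age `k` (`hrowk`: its damped row mass non-increasing in the pin): `P ≡ False` — the age 1 is
one-lag ((E82c) `flow_hSb_one` supplies its (S-b)), the ages `2 … k−1` are silent ((E82e)), the oldest age needs nothing ((E83e)), so (S-c♯) is never
asked.  This supersedes (E82e) `flow_nonneg_two_ages_oldest` (`hold2`, `hSc`, `hScp` dropped) and makes the relaxed-class obstruction of (E83b) (the old
age's MONO″ ≡ (M1) FAILS there under a saturated young age, k ≥ 64) irrelevant: that object is not on the END's path — consistently the END's conclusion
holds there with `ε∕e ≥ 0.33` (`g74/numerics/o6.py`).  §3 **`flow_nonneg_two_ages_undamped`**: with `g ≡ 1` (a member of the relaxed class) the row mass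
of the age `k` is `k·L_kh_{n+k}³∕2`, non-increasing in the pin (`undamped_row`) — so THE UNDAMPED TWO-AGE END HOLDS WITH NO HYPOTHESIS: for every isotone
memory with floor dominated by a two-age profile and every box solution, every admissible excess has a non-negative first-order comparison surplus.
WHAT IS LEFT for the damped two-age END: (S-a) for the old age ALONE (numerics: ratio ≤ 0.97 along flows in the classes one∕self∕lower, k ≤ 8 here, g72
m13∕m14: ≤ 0.9994 up to k = 1000 self-consistently; thin for far old ages under a saturated young age, and broken by ≈ 0.08 % at k = 300 by an adversarial
RELAXED damping (g72 README §2) — the robust substitute is g72 §3 (a)'s decay form, successor item (1)).  NOT CLAIMED: (S-a) along damped flows; three or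
more loaded ages; anything nonlinear; anything printed.

WHAT IS PROVED ([folklore]; 0 `def`, 0 sorry).  §1 **`flow_nonneg_of_static_families_levels`**; §2 **`flow_nonneg_two_ages_rowmass`**; §3 `undamped_row`,
**`flow_nonneg_two_ages_undamped`**.
-/
noncomputable section
open Finset

namespace Summit.QuantumFields.BalabanUV.Beta.EriceRemainderEnclosureHistoryAutonomyComparisonAgeCompositionStaticEndLevelsFlow

open Literature.MathematicalPhysics.QuantumFieldTheory.Balaban1983to89
open Literature.MathematicalPhysics.QuantumFieldTheory.Balaban1983to89.T4BetaStationary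
open Literature.MathematicalPhysics.QuantumFieldTheory.Balaban1983to89.T4BetaFlowWellPosed
open Summit.QuantumFields.BalabanUV.Beta.EriceRemainderEnclosureHistoryAutonomyOrder (strictAnti_of_memFlow)
open Summit.QuantumFields.BalabanUV.Beta.EriceRemainderEnclosureHistoryAutonomyComparisonAgeCompositionIdentification
open Summit.QuantumFields.BalabanUV.Beta.EriceRemainderEnclosureHistoryAutonomyComparisonAgeCompositionChainWiringAtPin
open Summit.QuantumFields.BalabanUV.Beta.EriceRemainderEnclosureHistoryAutonomyComparisonAgeCompositionCriteriaFlow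
open Summit.QuantumFields.BalabanUV.Beta.EriceRemainderEnclosureHistoryAutonomyComparisonAgeCompositionStaticEndFlow
open Summit.QuantumFields.BalabanUV.Beta.EriceRemainderEnclosureHistoryAutonomyComparisonAgeCompositionStaticEndOldestFlow (silent_row silent_tail_sums)
open Summit.QuantumFields.BalabanUV.Beta.EriceRemainderEnclosureHistoryAutonomyComparisonAgeCompositionStaticEndLevels
open Summit.QuantumFields.BalabanUV.Beta.EriceRemainderEnclosureHistoryAutonomyComparisonAgeCompositionYoungestTailSumWiring

variable {B : (ℕ → ℝ) → ℝ} {γ b gIR : ℝ} {L : ℕ → ℝ} {K : ℕ} {h g : ℕ → ℝ} {KL : ℕ → ℕ → ℕ → ℝ}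

/-! ## §1 (E83g)'s END for the flow -/

/-- **ROUTE (N), FIRST ORDER, END FOR THE FLOW — EACH LEVEL ASKED ONLY WHAT IT USES.**  As (E82e) `flow_nonneg_of_static_families_oldest` on (E83g)
`nonneg_of_static_families_levels`: (S-b) for the ages `< K − 1`; (S-c♯) only at the levels `i` with `P i`; every level `i < K − 1` one-lag (`i = 1`), silent
(zero kernel) or followed by a `P`-level (`hlev`); nothing for the oldest age beyond (S-a). [folklore] -/
theorem flow_nonneg_of_static_families_levels (hmono : ∀ u v : ℕ → ℝ, SeqBox γ u → SeqBox γ v → (∀ j, u j ≤ v j) → B u ≤ B v)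
    (hL : ∀ k, 0 ≤ L k) (hb : 0 < b) (hlo : ∀ u, SeqBox γ u → b ≤ B u) (hdom : ∀ u, SeqBox γ u → ∑ k ∈ range K, L k * u k ≤ B u)
    (hh : SeqBox γ h) (hf : MemFlow B gIR h)
    (hg : ∀ t, 0 < g t ∧ g t ≤ 1) (hgF : ∀ t, 1 / (1 + ∑ k ∈ range K, L k * h (t + k) ^ 3 / 2) ≤ g t) (hK : 2 ≤ K)
    (hKL : ∀ k n l, KL k n l = if 0 < k ∧ k < K ∧ l < k then L k * h (n + k) ^ 3 / 2 * ∏ t ∈ Ico (n + 1 + l) (n + k + 1), g t else 0)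
    {θ : ℕ → ℕ → ℕ → ℝ} (hθ : ∀ k n l, θ k n l = 1 - (h (n + k + l) / h (n + k)) ^ 3 * ∏ t ∈ Ico (n + k + 1) (n + k + l + 1), g t)
    {KA : ℕ → ℕ → ℕ → ℝ} {RL RA SL SA : ℕ → (ℕ → ℝ) → ℕ → ℝ}
    (hRL : ∀ i v m, RL i v m = ∑ l ∈ range K, KL i m l * v (m + 1 + l))
    (hRA : ∀ i v m, RA i v m = ∑ l ∈ range K, KA i m l * v (m + 1 + l))
    (hKA : ∀ i m l, KA i m l = KL i m l + KA (i + 1) m l) (hKAtop : ∀ m l, KA K m l = 0)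
    (hSL : ∀ i (w : ℕ → ℝ), (∀ m, K < m → w m = 0) → (∀ m, K < m → SL i w m = 0) ∧ ∀ m, SL i w m = w m - RL i (SL i w) m)
    (hSA : ∀ i (w : ℕ → ℝ), (∀ m, K < m → w m = 0) → (∀ m, K < m → SA i w m = 0) ∧ ∀ m, SA i w m = w m - RA i (SA i w) m)
    {ρ : ℕ → ℕ → ℝ} {β : ℕ → ℕ → ℕ → ℝ}
    (hρ : ∀ i n, 1 ≤ i → i ≤ K - 1 → ρ i n = (∑ l ∈ range K, KL i n l) * (1 + ∑ k ∈ Ioc i (K - 1), θ k n i * β (i + 1) n k) /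
      (1 - ∑ k ∈ Ioc i (K - 1), ∑ l ∈ range i, KL k n l))
    (hβnew : ∀ i n, 1 ≤ i → i ≤ K - 1 → β i n i = ρ i n / (1 - ρ i n))
    (hβold : ∀ i n k, 1 ≤ i → i < k → k ≤ K - 1 → β i n k = β (i + 1) n k / (1 - ρ i n))
    (hrow : ∀ k n, 2 ≤ k → k < K → ∑ l ∈ range k, KL k (n + 1) l ≤ ∑ l ∈ range k, KL k n l)
    {Hg : ℕ → ℕ → ℝ} (hH : ∀ i m, Hg i m = (1 + ∑ k ∈ Ioc i (K - 1), θ k m 1 * β (i + 1) m k) / (1 - ∑ k ∈ Ioc i (K - 1), KL k m 0))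
    {M : ℕ → ℕ → ℝ} (hM : ∀ i m, M i m = KL i m 0 + ∑ l ∈ range (K - 1), max (KL i m (l + 1) - KL i (m + 1) l) 0)
    (hSb : ∀ i m, 1 ≤ i → i < K - 1 → ∀ L', L' < i →
      (1 + M i m) * ∑ l ∈ Ico L' i, Hg i (m + 1 + l) * KL i (m + 1) l ≤ ∑ l ∈ Ico L' i, KL i m l)
    (hSbp : ∀ i m, 1 ≤ i → i < K - 1 → ∀ L₀, L₀ < i → ∀ L', L' ≤ L₀ →
      (1 + M i m) * ∑ l ∈ Ico L' L₀, Hg i (m + 1 + l) * KL i (m + 1) l ≤ ∑ l ∈ Ico L' (L₀ + 1), KL i m l)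
    {HgS : ℕ → ℕ → ℕ → ℝ} (hHS : ∀ i j m, HgS i j m = (1 + ∑ k ∈ Ioc i (K - 1), θ k m 1 * β (i + 1) m k) /
      (1 - ∑ k ∈ Ioc i (K - 1), (KL k m 0 - if m + 1 + k ≤ j then KL k (m + 1) (k - 1) else 0)))
    {P : ℕ → Prop} (hlev : ∀ i, 1 ≤ i → i < K - 1 → i = 1 ∨ (∀ m l, KL i m l = 0) ∨ P (i + 1))
    (hSc : ∀ i m j, 1 ≤ i → i ≤ K - 1 → P i → m + 1 + K ≤ j → ∀ L', L' < K →
      ∑ l ∈ Ico L' K, HgS (i - 1) j (m + 1 + l) * KA i (m + 1) l ≤ ∑ l ∈ Ico L' K, KA i m l)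
    (hScp : ∀ i m L₀, 1 ≤ i → i ≤ K - 1 → P i → L₀ < K → ∀ L', L' ≤ L₀ →
      ∑ l ∈ Ico L' L₀, HgS (i - 1) (m + 1 + L₀) (m + 1 + l) * KA i (m + 1) l ≤ ∑ l ∈ Ico L' (L₀ + 1), KA i m l)
    {e ε : ℕ → ℝ} (he0 : ∀ m, 0 ≤ e m) (hea : ∀ m, e (m + 1) ≤ e m) (het : ∀ m, K < m → e m = 0)
    (hεt : ∀ m, K < m → ε m = 0) (hεrec : ∀ m, ε m = e m - RA 1 ε m) : ∀ m, 0 ≤ ε m := by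
  have hh0 : ∀ n, 0 < h n := fun n => (hh n).1
  have hanti := (strictAnti_of_memFlow hb hlo hh hf).antitone
  have hac := fun n i (hi1 : 1 ≤ i) (hiK : i ≤ K - 1) =>
    age_chain_closes hmono hL hb hlo hdom hh hf hg hgF hKL hθ hρ hβnew hβold n hi1 hiK
  have hcumL : ∀ k, 1 ≤ k → k ≤ K - 1 → ∀ m M', ∑ l ∈ range (M' + 1), KL k (m + 1) l ≤ ∑ l ∈ range (M' + 2), KL k m l := by
    intro k hk1 hkK m M'
    refine flow_cum_dom_of_rowmass hL hh0 hanti hg hKL (fun n => ?_) m M'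
    rcases Nat.lt_or_ge k 2 with hk2 | hk2
    · have : k = 1 := by omega
      subst this
      exact flow_rowmass_one hmono hL hb hlo hdom hh hf hg hgF hK hKL n
    · exact hrow k n hk2 (by omega)
  exact nonneg_of_static_families_levels (N := K) (n := K - 1) (y := fun i => i) (KL := KL) (θ := θ)
    (weight_nonneg hL hh0 hg hKL) (weight_eq_zero_of_horizon hKL)
    (fun i m l hl => by rw [hKL, if_neg (fun h3 => by omega)])
    hRL hRA hKA (fun m l => by rw [Nat.sub_add_cancel (by omega : 1 ≤ K)]; exact hKAtop m l) hSL hSA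
    (fun i hi1 hiK => ⟨hi1, by omega⟩)
    (defect_nonneg hh0 hanti hg hθ) (persistence hL hh0 hg hKL hθ) (fun k m l l' hll' => defect_mono hh0 hanti hg hθ k m hll')
    hρ hβnew hβold (fun i m hi1 hiK => (hac m i hi1 hiK).2) (fun i m hi1 hiK => (hac m i hi1 hiK).1) hcumL
    (fun i m _ => flow_lag_zero_mass_lt_one hmono hL hb hlo hdom hh hf hg hKL i m) hH hM hSb hSbp hHS hlev hSc hScp he0 hea het hεt hεrec

/-! ## §2 Silent ages: (E82e) `silent_row`, `silent_tail_sums` (imported) -/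

/-! ## §2 The two-age END on (S-a) for the old age ALONE -/

/-- **ROUTE (N), FIRST ORDER, END FOR TWO-AGE FLOWS — ON ONE STATIC FAMILY, EVERY DAMPING IN THE RELAXED CLASS.**  `B` isotone with floor `b > 0`
dominated by a two-age profile (`L_j = 0` for `j ∉ {1, k}`, `2 ≤ k`, horizon `K = k + 1`); `h` a box solution; `g` any damping with `1∕(1+F_t) ≤ g_t ≤ 1`;
the first-order objects of route (N) as in (E81k) (the growth factors `HgS` of (S-c♯) are displayed for the record but no inequality on them is asked).
THE ONLY HYPOTHESIS: `hrowk` — (S-a) for the age `k` (its damped row mass non-increasing in the pin).  CONCLUSION: the comparison surplus `ε` of every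
admissible excess `e` is non-negative.  ((S-b) at the age `1`: (E82c) `flow_hSb_one`; silent ages: (E82e) `silent_row`, `silent_tail_sums`; the old age:
nothing, (E83e)∕(E83g); (S-c♯): never asked, `P ≡ False`.) [folklore] -/
theorem flow_nonneg_two_ages_rowmass (hmono : ∀ u v : ℕ → ℝ, SeqBox γ u → SeqBox γ v → (∀ j, u j ≤ v j) → B u ≤ B v)
    (hL : ∀ k, 0 ≤ L k) (hb : 0 < b) (hlo : ∀ u, SeqBox γ u → b ≤ B u) (hdom : ∀ u, SeqBox γ u → ∑ k ∈ range K, L k * u k ≤ B u)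
    (hh : SeqBox γ h) (hf : MemFlow B gIR h)
    (hg : ∀ t, 0 < g t ∧ g t ≤ 1) (hgF : ∀ t, 1 / (1 + ∑ k ∈ range K, L k * h (t + k) ^ 3 / 2) ≤ g t)
    {k : ℕ} (hk2 : 2 ≤ k) (hKk : K = k + 1) (hL2 : ∀ j, j < K → j ≠ 1 → j ≠ k → L j = 0)
    (hKL : ∀ k n l, KL k n l = if 0 < k ∧ k < K ∧ l < k then L k * h (n + k) ^ 3 / 2 * ∏ t ∈ Ico (n + 1 + l) (n + k + 1), g t else 0)
    {θ : ℕ → ℕ → ℕ → ℝ} (hθ : ∀ k n l, θ k n l = 1 - (h (n + k + l) / h (n + k)) ^ 3 * ∏ t ∈ Ico (n + k + 1) (n + k + l + 1), g t)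
    {KA : ℕ → ℕ → ℕ → ℝ} {RL RA SL SA : ℕ → (ℕ → ℝ) → ℕ → ℝ}
    (hRL : ∀ i v m, RL i v m = ∑ l ∈ range K, KL i m l * v (m + 1 + l))
    (hRA : ∀ i v m, RA i v m = ∑ l ∈ range K, KA i m l * v (m + 1 + l))
    (hKA : ∀ i m l, KA i m l = KL i m l + KA (i + 1) m l) (hKAtop : ∀ m l, KA K m l = 0)
    (hSL : ∀ i (w : ℕ → ℝ), (∀ m, K < m → w m = 0) → (∀ m, K < m → SL i w m = 0) ∧ ∀ m, SL i w m = w m - RL i (SL i w) m)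
    (hSA : ∀ i (w : ℕ → ℝ), (∀ m, K < m → w m = 0) → (∀ m, K < m → SA i w m = 0) ∧ ∀ m, SA i w m = w m - RA i (SA i w) m)
    {ρ : ℕ → ℕ → ℝ} {β : ℕ → ℕ → ℕ → ℝ}
    (hρ : ∀ i n, 1 ≤ i → i ≤ K - 1 → ρ i n = (∑ l ∈ range K, KL i n l) * (1 + ∑ k ∈ Ioc i (K - 1), θ k n i * β (i + 1) n k) /
      (1 - ∑ k ∈ Ioc i (K - 1), ∑ l ∈ range i, KL k n l))
    (hβnew : ∀ i n, 1 ≤ i → i ≤ K - 1 → β i n i = ρ i n / (1 - ρ i n))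
    (hβold : ∀ i n k, 1 ≤ i → i < k → k ≤ K - 1 → β i n k = β (i + 1) n k / (1 - ρ i n))
    (hrowk : ∀ n, ∑ l ∈ range k, KL k (n + 1) l ≤ ∑ l ∈ range k, KL k n l)
    {Hg : ℕ → ℕ → ℝ} (hH : ∀ i m, Hg i m = (1 + ∑ k ∈ Ioc i (K - 1), θ k m 1 * β (i + 1) m k) / (1 - ∑ k ∈ Ioc i (K - 1), KL k m 0))
    {M : ℕ → ℕ → ℝ} (hM : ∀ i m, M i m = KL i m 0 + ∑ l ∈ range (K - 1), max (KL i m (l + 1) - KL i (m + 1) l) 0)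
    {HgS : ℕ → ℕ → ℕ → ℝ} (hHS : ∀ i j m, HgS i j m = (1 + ∑ k ∈ Ioc i (K - 1), θ k m 1 * β (i + 1) m k) /
      (1 - ∑ k ∈ Ioc i (K - 1), (KL k m 0 - if m + 1 + k ≤ j then KL k (m + 1) (k - 1) else 0)))
    {e ε : ℕ → ℝ} (he0 : ∀ m, 0 ≤ e m) (hea : ∀ m, e (m + 1) ≤ e m) (het : ∀ m, K < m → e m = 0)
    (hεt : ∀ m, K < m → ε m = 0) (hεrec : ∀ m, ε m = e m - RA 1 ε m) : ∀ m, 0 ≤ ε m := by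
  have hkK : k < K := by omega
  obtain ⟨h1, h1p⟩ := flow_hSb_one hmono hL hb hlo hdom hh hf hg hgF hk2 hkK hL2 hKL hθ hρ hβnew hβold hH hM
  refine flow_nonneg_of_static_families_levels hmono hL hb hlo hdom hh hf hg hgF (by omega) hKL hθ hRL hRA hKA hKAtop hSL hSA hρ hβnew hβold
    (fun k' n hk'2 hk'K => ?_) hH hM (fun i m hi1 hiK L' hL' => ?_) (fun i m hi1 hiK L₀ hL₀ L' hL' => ?_) hHS (P := fun _ => False)
    (fun i hi1 hiK => ?_) (fun i m j _ _ hP => hP.elim) (fun i m L₀ _ _ hP => hP.elim) he0 hea het hεt hεrec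
  · by_cases hkk : k' = k
    · subst hkk; exact hrowk n
    · exact silent_row hKL (hL2 k' hk'K (by omega) hkk) n
  · rcases Nat.lt_or_ge i 2 with hi | hi
    · obtain rfl : i = 1 := by omega
      exact h1 m L' hL'
    · exact silent_tail_sums hKL (hL2 i (by omega) (by omega) (by omega)) m _ _
  · rcases Nat.lt_or_ge i 2 with hi | hi
    · obtain rfl : i = 1 := by omega
      exact h1p m L₀ hL₀ L' hL'
    · exact silent_tail_sums hKL (hL2 i (by omega) (by omega) (by omega)) m _ _
  · rcases Nat.lt_or_ge i 2 with hi | hi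
    · exact Or.inl (by omega)
    · exact Or.inr (Or.inl fun m l => kernel_zero hKL (hL2 i (by omega) (by omega) (by omega)) m l)

/-! ## §3 The undamped two-age END: no hypothesis left -/

/-- Without damping the row mass of an age is `k` times its coefficient, non-increasing in the pin (`h` antitone): (S-a) is free. [folklore] -/
theorem undamped_row (hL : ∀ k, 0 ≤ L k) (hh : SeqBox γ h) (hanti : Antitone h) (hg1 : ∀ t, g t = 1)
    (hKL : ∀ k n l, KL k n l = if 0 < k ∧ k < K ∧ l < k then L k * h (n + k) ^ 3 / 2 * ∏ t ∈ Ico (n + 1 + l) (n + k + 1), g t else 0)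
    (k n : ℕ) : ∑ l ∈ range k, KL k (n + 1) l ≤ ∑ l ∈ range k, KL k n l := by
  refine sum_le_sum fun l hl => ?_
  have hl' := mem_range.mp hl
  rw [hKL, hKL]
  by_cases hk : 0 < k ∧ k < K
  · rw [if_pos ⟨hk.1, hk.2, hl'⟩, if_pos ⟨hk.1, hk.2, hl'⟩, prod_eq_one fun t _ => hg1 t, prod_eq_one fun t _ => hg1 t, mul_one, mul_one,
      show n + 1 + k = n + k + 1 by ring]
    have h1 : h (n + k + 1) ^ 3 ≤ h (n + k) ^ 3 := pow_le_pow_left₀ (hh _).1.le (hanti (by omega)) 3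
    have := hL k
    nlinarith
  · rw [if_neg (fun h3 => hk ⟨h3.1, h3.2.1⟩), if_neg (fun h3 => hk ⟨h3.1, h3.2.1⟩)]

/-- **ROUTE (N), FIRST ORDER — THE UNDAMPED TWO-AGE END, UNCONDITIONAL.**  As `flow_nonneg_two_ages_rowmass` in the undamped first-order model (`g ≡ 1`,
a member of the relaxed class): (S-a) for the age `k` is `undamped_row`.  So for every isotone memory `B` with floor `b > 0` dominated by a two-age profile
`{1, k}` (`2 ≤ k`), every box solution `h`, the undamped first-order objects of route (N) on the horizon `K = k + 1`, and every admissible excess `e`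
(non-negative, non-increasing, supported in `[0, K]`), the comparison surplus `ε = e − RA 1 ε` is non-negative at every depth — NO hypothesis of the
census is left. [folklore] -/
theorem flow_nonneg_two_ages_undamped (hmono : ∀ u v : ℕ → ℝ, SeqBox γ u → SeqBox γ v → (∀ j, u j ≤ v j) → B u ≤ B v)
    (hL : ∀ k, 0 ≤ L k) (hb : 0 < b) (hlo : ∀ u, SeqBox γ u → b ≤ B u) (hdom : ∀ u, SeqBox γ u → ∑ k ∈ range K, L k * u k ≤ B u)
    (hh : SeqBox γ h) (hf : MemFlow B gIR h) (hg1 : ∀ t, g t = 1)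
    {k : ℕ} (hk2 : 2 ≤ k) (hKk : K = k + 1) (hL2 : ∀ j, j < K → j ≠ 1 → j ≠ k → L j = 0)
    (hKL : ∀ k n l, KL k n l = if 0 < k ∧ k < K ∧ l < k then L k * h (n + k) ^ 3 / 2 * ∏ t ∈ Ico (n + 1 + l) (n + k + 1), g t else 0)
    {θ : ℕ → ℕ → ℕ → ℝ} (hθ : ∀ k n l, θ k n l = 1 - (h (n + k + l) / h (n + k)) ^ 3 * ∏ t ∈ Ico (n + k + 1) (n + k + l + 1), g t)
    {KA : ℕ → ℕ → ℕ → ℝ} {RL RA SL SA : ℕ → (ℕ → ℝ) → ℕ → ℝ}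
    (hRL : ∀ i v m, RL i v m = ∑ l ∈ range K, KL i m l * v (m + 1 + l))
    (hRA : ∀ i v m, RA i v m = ∑ l ∈ range K, KA i m l * v (m + 1 + l))
    (hKA : ∀ i m l, KA i m l = KL i m l + KA (i + 1) m l) (hKAtop : ∀ m l, KA K m l = 0)
    (hSL : ∀ i (w : ℕ → ℝ), (∀ m, K < m → w m = 0) → (∀ m, K < m → SL i w m = 0) ∧ ∀ m, SL i w m = w m - RL i (SL i w) m)
    (hSA : ∀ i (w : ℕ → ℝ), (∀ m, K < m → w m = 0) → (∀ m, K < m → SA i w m = 0) ∧ ∀ m, SA i w m = w m - RA i (SA i w) m)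
    {ρ : ℕ → ℕ → ℝ} {β : ℕ → ℕ → ℕ → ℝ}
    (hρ : ∀ i n, 1 ≤ i → i ≤ K - 1 → ρ i n = (∑ l ∈ range K, KL i n l) * (1 + ∑ k ∈ Ioc i (K - 1), θ k n i * β (i + 1) n k) /
      (1 - ∑ k ∈ Ioc i (K - 1), ∑ l ∈ range i, KL k n l))
    (hβnew : ∀ i n, 1 ≤ i → i ≤ K - 1 → β i n i = ρ i n / (1 - ρ i n))
    (hβold : ∀ i n k, 1 ≤ i → i < k → k ≤ K - 1 → β i n k = β (i + 1) n k / (1 - ρ i n))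
    {Hg : ℕ → ℕ → ℝ} (hH : ∀ i m, Hg i m = (1 + ∑ k ∈ Ioc i (K - 1), θ k m 1 * β (i + 1) m k) / (1 - ∑ k ∈ Ioc i (K - 1), KL k m 0))
    {M : ℕ → ℕ → ℝ} (hM : ∀ i m, M i m = KL i m 0 + ∑ l ∈ range (K - 1), max (KL i m (l + 1) - KL i (m + 1) l) 0)
    {HgS : ℕ → ℕ → ℕ → ℝ} (hHS : ∀ i j m, HgS i j m = (1 + ∑ k ∈ Ioc i (K - 1), θ k m 1 * β (i + 1) m k) /
      (1 - ∑ k ∈ Ioc i (K - 1), (KL k m 0 - if m + 1 + k ≤ j then KL k (m + 1) (k - 1) else 0)))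
    {e ε : ℕ → ℝ} (he0 : ∀ m, 0 ≤ e m) (hea : ∀ m, e (m + 1) ≤ e m) (het : ∀ m, K < m → e m = 0)
    (hεt : ∀ m, K < m → ε m = 0) (hεrec : ∀ m, ε m = e m - RA 1 ε m) : ∀ m, 0 ≤ ε m := by
  have hg : ∀ t, 0 < g t ∧ g t ≤ 1 := fun t => by rw [hg1 t]; norm_num
  have hgF : ∀ t, 1 / (1 + ∑ k ∈ range K, L k * h (t + k) ^ 3 / 2) ≤ g t := fun t => by
    have hS : 0 ≤ ∑ k ∈ range K, L k * h (t + k) ^ 3 / 2 :=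
      sum_nonneg fun k _ => by have := hL k; have := (hh (t + k)).1; positivity
    rw [hg1 t, div_le_one (by linarith)]
    linarith
  have hanti := (strictAnti_of_memFlow hb hlo hh hf).antitone
  exact flow_nonneg_two_ages_rowmass hmono hL hb hlo hdom hh hf hg hgF hk2 hKk hL2 hKL hθ hRL hRA hKA hKAtop hSL hSA hρ hβnew hβold
    (fun n => undamped_row hL hh hanti hg1 hKL k n) hH hM hHS he0 hea het hεt hεrec

end Summit.QuantumFields.BalabanUV.Beta.EriceRemainderEnclosureHistoryAutonomyComparisonAgeCompositionStaticEndLevelsFlow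

end
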